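import Literature.AnabelianGeometry.EtaleTheta.Discharge.Sec3Cor38RowsAssembly
import Literature.AnabelianGeometry.EtaleTheta.Discharge.Sec3Cor38StdIsoNotGLUnconditional
import Literature.AnabelianGeometry.EtaleTheta.Discharge.Sec3HQOfRationalSupport
import Literature.AnabelianGeometry.EtaleTheta.Discharge.Sec3Cor38CriterionCoordOfRlf
import Literature.AnabelianGeometry.EtaleTheta.Discharge.Sec3RatFnMonoidOn
import Literature.AnabelianGeometry.EtaleTheta.Discharge.Sec3BLambdaInjectiveOfRlf
import Literature.AlgebraicGeometry.Frobenioids.EquivalencePreStepsFSMFF2008Assembly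
import HarnessLib

/-!
# [EtTh] Corollary 3.8 (i) AS TYPED — the criterion C38-L05 consumed from RATIONAL SUPPORT, row C38-L01 with
# no residual: the node closer's inputs become print-level clauses on the Def. 3.3 (iii) / Def. 3.6 (i) data

S. Mochizuki, *The étale theta function and its Frobenioid-theoretic manifestations*, Publ. RIMS **45** (2009),
Cor. 3.8 (i), statement PDF p. 80, proof PDF p. 81 l. 13–32 [cite: MochizukiEtTh2009, Cor 3.8 p.81]; Def. 3.6
(i)/(ii) pp. 76–77 (`Φ ⊆ Φ^{ℝ-log} := Φ₀^ℝ|_D`, `Φ₀^ℤ = Φ₀`, `Φ₀^ℚ = Φ₀^pf`) [cite: MochizukiEtTh2009, Def 3.6 p.76];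
Remark 3.3.1 p. 73 (every `Φ₀(Y)_𝔭 ≅ ℤ_{≥0}`); Prop. 3.4 (ii) p. 74; S. Mochizuki, *The geometry of Frobenioids I*,
Kyushu J. Math. **62** (2008), Thm. 3.4 (ii) p. 62 [cite: MochizukiFrdI2008, Thm. 3.4 (ii) p.62], Thm. 5.2 (ii)
p. 100.

abc-iut cell, layer L2, cone node `EtTh:Cor3.8(i)` (kernel id `N_EtTh_Cor3_8_i`), seat abc-iut-w6-d039 (gen 3);
PROOF-ONLY sequel (0 definitions) of this lineage's node-level knits `Discharge/Sec3Cor38iAssembly.lean`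
(p430168, `Cor38Hyp.cor38_i_of_thm34ii`) and `Discharge/Sec3Cor38iAssemblyHolds.lean` (p433112/p434302,
`Cor38Hyp.cor38_i_of_isOfStandardType` / `cor38_i_treeVocab` / `cor38_i_treeVocab_of_data`), whose inputs per side
were `hF_i` / `hBmon_i` ([FrdI] Thm. 5.2 (ii) / its preamble), `hstd_i` ([EtTh] Thm. 3.7 (ii)) and the DATA SHAPES
`hP34Λ`, `hLine`, `hInt`, `hSup` of row C38-L05 of `plan/L2/SUBDAG-EtTh-Cor38.md` (cell GAP-LEDGER G-w5d124-1/2/3).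
It is the Cor. 3.8 (i) twin of abc-iut-w6-d040's `Discharge/Sec3Cor38iiOfRatSupport.lean` (p437110), i.e. the
(i)-half of the wiring asked for in abc-iut-w5-d130's HANDOFF, follow-up (i).

WHAT THIS FILE DOES.  Two inputs of the printed proof are now THEOREMS of the tree with no residual, and are
consumed BY NAME:
* row C38-L01 ("by Theorem 3.7, (i), (ii), `C₁`, `C₂` are of standard and isotropic type, but not of group-like
  type", p.81 l.13–14) — abc-iut-f-132's `Cor38Hyp.standardIsotropicNotGroupLike_treeMonoidVocab` (p. of
  `Sec3Cor38StdIsoNotGLUnconditional`): NO binder at the canonical monoid vocabulary, ANY category vocabulary —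
  so the `hstd_i` of `cor38_i_of_thm34ii` / `cor38_i_of_isOfStandardType` DROP OUT;
* "[Mzk17], Theorem 3.4, (ii)" — abc-iut-L1's `FrdI.Thm34ii_holds` (F-0711 PROVED);
and the criterion C38-L05 at THE perfection is consumed from abc-iut-w5-d130's
`TemperedFrobenioid.bsFldPreStepLimitCriterion_of_ratSupport` (p433386; over abc-iut-w4-d084's
`bsFldPreStepLimitCriterion_of_coord'`, p430420), whose inputs are PRINT-LEVEL CLAUSES on the Def. 3.3 (iii) /
Def. 3.6 (i) data `(Φ₀, B₀, F₀, B₀^Λ, F₀^Λ)` and on `Φ ⊆ Φ₀^ℝ|_D`: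
`hP34Λ` (Prop. 3.4 (ii) at monoid type `Λ` — the typed field `Prop34Cnst.mem_FΛ_of_divΛ_eq_of`), `hNZ` (Def. 3.6
(ii)(b): a non-zero effective divisor of constants), `hZQ` (Rmk. 3.3.1: every prime of `Φ₀(Y_W)` is a `ℤ`- or a
`ℚ`-prime), `hsat` (Def. 3.6 (i)/(ii) for `Λ ∈ {ℤ, ℚ}`: `Φ(W)` has rational support in `Φ₀^ℝ(Y_W)`); at the
CONSTRUCTED `Λ = ℤ / ℚ` data `ofRlfZ` / `ofRlfQ` its `bsFldPreStepLimitCriterion_ofRlfZ_of_ratSupport` /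
`…ofRlfQ…` (p434562: `dm.Prop34`, `hcyc`, `hZQ`, `hsat` — `B₀`/`Φ₀`-level statements only).

THEOREMS (all conclude abc-iut-L2-t3's `Cor38_i` AS TYPED, vocabulary parameter := L1's `IsFrobeniusSlim`, for
`h : Cor38Hyp C₁ C₂`):
* §1, canonical MONOID vocabulary `treeMonoidVocab`, ARBITRARY category vocabularies `VD_i` —
  `Cor38Hyp.cor38_i_of_ratSupport`: inputs `hF_i` ([FrdI] Thm. 5.2 (ii): the model category is a Frobenioid)
  and, per side, (`hP34Λ_i`, `hNZ_i`, `hZQ_i`, `hsat_i`); `Cor38Hyp.cor38_i_of_ratSupport_of_prop34Cnst`: the same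
  with `hP34Λ_i` ⟸ the typed Prop. 3.4 (ii) structure `T_i.Prop34Cnst cnst_i`;
* §2, canonical vocabularies `treeMonoidVocab` / `treeCatVocab` — `Cor38Hyp.cor38_i_canonical_of_ratSupport`:
  inputs `hBmon_i` ("`𝔹_i` is a monoid on `D_i`", [FrdI] Thm. 5.2 preamble; abc-iut-L2's standing residual) +
  the four clauses; `Cor38Hyp.cor38_i_canonical_of_structural`: `hBmon_i` ⟸ (`hBinj_i`, `hFSM_i`) through
  abc-iut-L2-t3's `isFrobenioid_of_structural`, `hP34Λ_i` ⟸ `T_i.Prop34Cnst cnst_i` — EVERY input a named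
  print-level clause;
* §3, both tempered Frobenioids over the CONSTRUCTED Def. 3.6 (i) data of monoid type `ℤ` (resp. `ℚ`) —
  `Cor38Hyp.cor38_i_ofRlfZ_of_ratSupport` / `…_ofRlfQ_of_ratSupport` (any `VD_i`; inputs `hF_i`, `dm_i.Prop34`,
  `hcyc_i`, `hZQ_i`, `hsat_i` — `B₀`/`Φ₀`-level print statements only; at `treeCatVocab` pass
  `hF_i := C_i.isFrobenioid_treeCatVocab_of_isMonoidOn hBmon_i`) and `…_of_structural` (`hB₀inj_i`, `hFSM_i`
  through abc-iut-L2-t3's `RealifiedDivisorMonoids.ofRlfZ_hBinj` / `ofRlfQ_hBinj`): every input a named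
  `B₀`/`Φ₀`/`D`-level clause.

NET for the node's binder census (CERT-L2 / `AbcOfS` readers): Cor. 3.8 (i) AS TYPED ⟸ {`h : Cor38Hyp`,
per side ONE structural clause on the model category (`hF` | `hBmon` | `hBinj ∧ hFSM`) and the print-level data
clauses (`hP34Λ` | `Prop34Cnst`), `hNZ`, `hZQ`, `hsat` (resp. `Prop34`, `hcyc`, `hZQ`, `hsat` at `ofRlfZ`/`ofRlfQ`)} —
no `hstd`, no `h34`, no `hLine`/`hInt`/`hSup`/`hQ`, no criterion `h5`.  Nothing of L1 / abc-iut-w4-d008 / w4-d084 /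
w5-d124 / w5-d130 / f-132 / f-034 is re-derived; no statement of print is strengthened: `hsat`, `hcyc`, `hNZ`,
`hZQ` are print's standing situation for the geometric data and are NOT derivable from the typed interfaces
(kernel certificates `ToyHNZ` p427694, `Sec3Cor38CriterionToy` p425444, this lineage's `Sec3Cor38iStatementToy`
p432851 — the data clauses cannot be dropped from the typed statement).
HONEST FRAMING: refereed pre-IUT material ([EtTh] §3 over [FrdI] §§3–5); nothing here bears on [IUTchIII]
Cor. 3.12; no side taken; typed ≠ proved — here proved modulo the displayed named binders.
-/

namespace Literature.AnabelianGeometry.EtaleTheta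

open CategoryTheory Opposite Function Literature.AlgebraicGeometry.Frobenioids

universe u₀ v₀ u v w u₁ v₁

namespace Cor38Hyp

/-! ## §1 Canonical monoid vocabulary, arbitrary category vocabularies -/

section TreeMonoidVocab

variable {D₀ : Type u₀} [Category.{v₀} D₀] {D₀' : Type u₀} [Category.{v₀} D₀']
  {T : RealifiedDivisorMonoids (D₀ := D₀) treeMonoidVocab.{w}}
  {T' : RealifiedDivisorMonoids (D₀ := D₀') treeMonoidVocab.{w}}
  {D : Type u} [Category.{v} D] {D' : Type u} [Category.{v} D']
  {VD : FrdICatStub.{u, v, w} D} {VD' : FrdICatStub.{u, v, w} D'}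
  {C₁ : TemperedFrobenioid T D VD} {C₂ : TemperedFrobenioid T' D' VD'} (h : Cor38Hyp C₁ C₂)

/-- **[EtTh] Cor. 3.8 (i) AS TYPED at the canonical monoid vocabulary, ANY category vocabularies, the criterion
C38-L05 consumed from rational support and row C38-L01 with no residual**: for tempered Frobenioids `C₁`, `C₂`
whose model categories are Frobenioids ([FrdI] Thm. 5.2 (ii), `hF_i`), under `h : Cor38Hyp C₁ C₂` and GIVEN per
side the print-level clauses `hP34Λ_i` (Prop. 3.4 (ii) at monoid type `Λ`), `hNZ_i` (Def. 3.6 (ii)(b)), `hZQ_i`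
(Rmk. 3.3.1: primes of `Φ₀(Y_W)` of type `ℤ`/`ℚ`), `hsat_i` (Def. 3.6 (i)/(ii), `Λ ∈ {ℤ, ℚ}`: rational support of
`Φ_i(W)` in `Φ₀^ℝ(Y_W)`): if `D₁`, `D₂` are Frobenius-slim then `Ψ` preserves the base-field-theoretic morphisms.
Composition: abc-iut-f-034's `cor38_i_of_criterion` with `h34 := FrdI.Thm34ii_holds`, C38-L01 :=
`standardIsotropicNotGroupLike_treeMonoidVocab`, C38-L05 := abc-iut-w5-d130's
`bsFldPreStepLimitCriterion_of_ratSupport`. [cite: MochizukiEtTh2009, Cor 3.8 p.80] -/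
theorem cor38_i_of_ratSupport
    (hF₁ : PreFrobenioid.IsFrobenioid C₁.toElem) (hF₂ : PreFrobenioid.IsFrobenioid C₂.toElem)
    (hP34Λ₁ : ∀ (Y : D₀ᵒᵖ) (b : T.BΛ.obj Y) (r : T.ΦR.obj Y),
      T.divΛ Y b = Algebra.GrothendieckGroup.of r → b ∈ T.FΛ Y)
    (hNZ₁ : ∀ A : Dᵒᵖ, ∃ u : (T.BΛ.obj (C₁.baseOp A) : Type w) × Algebra.GrothendieckGroup (C₁.Φ.carrier A),
      u ∈ C₁.cnstFn A ∧ ∃ Z : C₁.Φ.carrier A, Z ≠ 1 ∧ u.2 = Algebra.GrothendieckGroup.of Z)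
    (hZQ₁ : ∀ (W : D) (𝔭 : Primes (T.Φ₀.obj (C₁.baseOp (op W)))),
      IsZMonoprime ↥𝔭.submonoid ∨ IsQMonoprime ↥𝔭.submonoid)
    (hsat₁ : ∀ (W : D), ∀ x ∈ C₁.Φ.carrier (op W), ∃ (N : ℕ+) (d : T.Φ₀.obj (C₁.baseOp (op W))),
      x ^ (N : ℕ) = T.toR (C₁.baseOp (op W)) d)
    (hP34Λ₂ : ∀ (Y : D₀'ᵒᵖ) (b : T'.BΛ.obj Y) (r : T'.ΦR.obj Y),
      T'.divΛ Y b = Algebra.GrothendieckGroup.of r → b ∈ T'.FΛ Y)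
    (hNZ₂ : ∀ A : D'ᵒᵖ, ∃ u : (T'.BΛ.obj (C₂.baseOp A) : Type w) × Algebra.GrothendieckGroup (C₂.Φ.carrier A),
      u ∈ C₂.cnstFn A ∧ ∃ Z : C₂.Φ.carrier A, Z ≠ 1 ∧ u.2 = Algebra.GrothendieckGroup.of Z)
    (hZQ₂ : ∀ (W : D') (𝔭 : Primes (T'.Φ₀.obj (C₂.baseOp (op W)))),
      IsZMonoprime ↥𝔭.submonoid ∨ IsQMonoprime ↥𝔭.submonoid)
    (hsat₂ : ∀ (W : D'), ∀ x ∈ C₂.Φ.carrier (op W), ∃ (N : ℕ+) (d : T'.Φ₀.obj (C₂.baseOp (op W))),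
      x ^ (N : ℕ) = T'.toR (C₂.baseOp (op W)) d) :
    Literature.AnabelianGeometry.EtaleTheta.Cor38_i
      (fun E _ => Literature.AlgebraicGeometry.Frobenioids.IsFrobeniusSlim E) h :=
  h.cor38_i_of_criterion FrdI.Thm34ii_holds hF₁ hF₂ h.standardIsotropicNotGroupLike_treeMonoidVocab
    (C₁.bsFldPreStepLimitCriterion_of_ratSupport hF₁ hP34Λ₁ hNZ₁ hZQ₁ hsat₁)
    (C₂.bsFldPreStepLimitCriterion_of_ratSupport hF₂ hP34Λ₂ hNZ₂ hZQ₂ hsat₂)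

/-- **[EtTh] Cor. 3.8 (i) AS TYPED at the canonical monoid vocabulary, any category vocabularies, with `hP34Λ_i`
read from the typed Prop. 3.4 (ii) structure** `RealifiedDivisorMonoids.Prop34Cnst` (abc-iut-L2-t3, field
`mem_FΛ_of_divΛ_eq_of`: "an element of `B₀^Λ(Y)` whose log-divisor is effective is a constant").  Inputs per
side: `hF_i`, `hP_i : T_i.Prop34Cnst cnst_i`, `hNZ_i`, `hZQ_i`, `hsat_i`. [cite: MochizukiEtTh2009, Cor 3.8 p.80] -/
theorem cor38_i_of_ratSupport_of_prop34Cnst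
    {Dcnst : Type u₁} [Category.{v₁} Dcnst] {cnst : D₀ ⥤ Dcnst}
    {Dcnst' : Type u₁} [Category.{v₁} Dcnst'] {cnst' : D₀' ⥤ Dcnst'}
    (hF₁ : PreFrobenioid.IsFrobenioid C₁.toElem) (hF₂ : PreFrobenioid.IsFrobenioid C₂.toElem)
    (hP₁ : T.Prop34Cnst cnst)
    (hNZ₁ : ∀ A : Dᵒᵖ, ∃ u : (T.BΛ.obj (C₁.baseOp A) : Type w) × Algebra.GrothendieckGroup (C₁.Φ.carrier A),
      u ∈ C₁.cnstFn A ∧ ∃ Z : C₁.Φ.carrier A, Z ≠ 1 ∧ u.2 = Algebra.GrothendieckGroup.of Z)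
    (hZQ₁ : ∀ (W : D) (𝔭 : Primes (T.Φ₀.obj (C₁.baseOp (op W)))),
      IsZMonoprime ↥𝔭.submonoid ∨ IsQMonoprime ↥𝔭.submonoid)
    (hsat₁ : ∀ (W : D), ∀ x ∈ C₁.Φ.carrier (op W), ∃ (N : ℕ+) (d : T.Φ₀.obj (C₁.baseOp (op W))),
      x ^ (N : ℕ) = T.toR (C₁.baseOp (op W)) d)
    (hP₂ : T'.Prop34Cnst cnst')
    (hNZ₂ : ∀ A : D'ᵒᵖ, ∃ u : (T'.BΛ.obj (C₂.baseOp A) : Type w) × Algebra.GrothendieckGroup (C₂.Φ.carrier A),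
      u ∈ C₂.cnstFn A ∧ ∃ Z : C₂.Φ.carrier A, Z ≠ 1 ∧ u.2 = Algebra.GrothendieckGroup.of Z)
    (hZQ₂ : ∀ (W : D') (𝔭 : Primes (T'.Φ₀.obj (C₂.baseOp (op W)))),
      IsZMonoprime ↥𝔭.submonoid ∨ IsQMonoprime ↥𝔭.submonoid)
    (hsat₂ : ∀ (W : D'), ∀ x ∈ C₂.Φ.carrier (op W), ∃ (N : ℕ+) (d : T'.Φ₀.obj (C₂.baseOp (op W))),
      x ^ (N : ℕ) = T'.toR (C₂.baseOp (op W)) d) :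
    Literature.AnabelianGeometry.EtaleTheta.Cor38_i
      (fun E _ => Literature.AlgebraicGeometry.Frobenioids.IsFrobeniusSlim E) h :=
  h.cor38_i_of_ratSupport hF₁ hF₂ hP₁.mem_FΛ_of_divΛ_eq_of hNZ₁ hZQ₁ hsat₁ hP₂.mem_FΛ_of_divΛ_eq_of hNZ₂
    hZQ₂ hsat₂

end TreeMonoidVocab

/-! ## §2 Canonical vocabularies `treeMonoidVocab` / `treeCatVocab` -/

section Canonical

variable {D₀ : Type u₀} [Category.{v₀} D₀] {D₀' : Type u₀} [Category.{v₀} D₀']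
  {T : RealifiedDivisorMonoids (D₀ := D₀) treeMonoidVocab.{w}}
  {T' : RealifiedDivisorMonoids (D₀ := D₀') treeMonoidVocab.{w}}
  {D : Type u} [Category.{v} D] {D' : Type u} [Category.{v} D']
  {IsRational IsStrictlyRational : (Dᵒᵖ ⥤ CommMonCat.{w}) → Prop}
  {IsRational' IsStrictlyRational' : (D'ᵒᵖ ⥤ CommMonCat.{w}) → Prop}
  {C₁ : TemperedFrobenioid T D (treeCatVocab D IsRational IsStrictlyRational)}
  {C₂ : TemperedFrobenioid T' D' (treeCatVocab D' IsRational' IsStrictlyRational')} (h : Cor38Hyp C₁ C₂)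

/-- **[EtTh] Cor. 3.8 (i) AS TYPED at the canonical vocabularies, the criterion C38-L05 consumed from rational
support**: inputs `hBmon_i` ("`𝔹_i` is a monoid on `D_i`", [FrdI] Thm. 5.2 preamble — it yields `hF_i` by
Thm. 5.2 (ii), `isFrobenioid_treeCatVocab_of_isMonoidOn`) and per side the print-level clauses `hP34Λ_i`,
`hNZ_i`, `hZQ_i`, `hsat_i`; row C38-L01 and [FrdI] Thm. 3.4 (ii) are tree theorems.  Supersedes this lineage's
`cor38_i_treeVocab_of_data` (binders `hP34Λ`, `hLine`, `hSup`) for readers who hold the Def. 3.3 (iii)-level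
clauses. [cite: MochizukiEtTh2009, Cor 3.8 p.80] -/
theorem cor38_i_canonical_of_ratSupport
    (hBmon₁ : IsMonoidOn C₁.ratFnFunctor) (hBmon₂ : IsMonoidOn C₂.ratFnFunctor)
    (hP34Λ₁ : ∀ (Y : D₀ᵒᵖ) (b : T.BΛ.obj Y) (r : T.ΦR.obj Y),
      T.divΛ Y b = Algebra.GrothendieckGroup.of r → b ∈ T.FΛ Y)
    (hNZ₁ : ∀ A : Dᵒᵖ, ∃ u : (T.BΛ.obj (C₁.baseOp A) : Type w) × Algebra.GrothendieckGroup (C₁.Φ.carrier A),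
      u ∈ C₁.cnstFn A ∧ ∃ Z : C₁.Φ.carrier A, Z ≠ 1 ∧ u.2 = Algebra.GrothendieckGroup.of Z)
    (hZQ₁ : ∀ (W : D) (𝔭 : Primes (T.Φ₀.obj (C₁.baseOp (op W)))),
      IsZMonoprime ↥𝔭.submonoid ∨ IsQMonoprime ↥𝔭.submonoid)
    (hsat₁ : ∀ (W : D), ∀ x ∈ C₁.Φ.carrier (op W), ∃ (N : ℕ+) (d : T.Φ₀.obj (C₁.baseOp (op W))),
      x ^ (N : ℕ) = T.toR (C₁.baseOp (op W)) d)
    (hP34Λ₂ : ∀ (Y : D₀'ᵒᵖ) (b : T'.BΛ.obj Y) (r : T'.ΦR.obj Y),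
      T'.divΛ Y b = Algebra.GrothendieckGroup.of r → b ∈ T'.FΛ Y)
    (hNZ₂ : ∀ A : D'ᵒᵖ, ∃ u : (T'.BΛ.obj (C₂.baseOp A) : Type w) × Algebra.GrothendieckGroup (C₂.Φ.carrier A),
      u ∈ C₂.cnstFn A ∧ ∃ Z : C₂.Φ.carrier A, Z ≠ 1 ∧ u.2 = Algebra.GrothendieckGroup.of Z)
    (hZQ₂ : ∀ (W : D') (𝔭 : Primes (T'.Φ₀.obj (C₂.baseOp (op W)))),
      IsZMonoprime ↥𝔭.submonoid ∨ IsQMonoprime ↥𝔭.submonoid)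
    (hsat₂ : ∀ (W : D'), ∀ x ∈ C₂.Φ.carrier (op W), ∃ (N : ℕ+) (d : T'.Φ₀.obj (C₂.baseOp (op W))),
      x ^ (N : ℕ) = T'.toR (C₂.baseOp (op W)) d) :
    Literature.AnabelianGeometry.EtaleTheta.Cor38_i
      (fun E _ => Literature.AlgebraicGeometry.Frobenioids.IsFrobeniusSlim E) h :=
  h.cor38_i_of_ratSupport (C₁.isFrobenioid_treeCatVocab_of_isMonoidOn hBmon₁)
    (C₂.isFrobenioid_treeCatVocab_of_isMonoidOn hBmon₂) hP34Λ₁ hNZ₁ hZQ₁ hsat₁ hP34Λ₂ hNZ₂ hZQ₂ hsat₂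

/-- **[EtTh] Cor. 3.8 (i) AS TYPED at the canonical vocabularies from NAMED PRINT-LEVEL CLAUSES ONLY**: the
standing residual `hBmon_i` is consumed from abc-iut-L2-t3's `isFrobenioid_of_structural` given `hBinj_i`
(pull-backs of `B₀^Λ` injective, [FrdI] Def. 1.1 (ii)) and `hFSM_i` (FSM-morphisms of `D_i` are isomorphisms), and
Prop. 3.4 (ii) at monoid type `Λ` from the typed structure `RealifiedDivisorMonoids.Prop34Cnst` (field
`mem_FΛ_of_divΛ_eq_of`).  Inputs per side: `hBinj_i`, `hFSM_i`, `hP_i : T_i.Prop34Cnst cnst_i`, `hNZ_i`, `hZQ_i`,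
`hsat_i` — one structural pair on `(B₀^Λ, D_i)` and four print-level clauses on the Def. 3.3 (iii) / 3.6 (i)
data; compare the (ii) twin `cor38_ii_canonical_of_structural` (one clause more: `hFinv_i`, for Rmk. 3.6.3).
[cite: MochizukiEtTh2009, Cor 3.8 p.80] -/
theorem cor38_i_canonical_of_structural
    {Dcnst : Type u₁} [Category.{v₁} Dcnst] {cnst : D₀ ⥤ Dcnst}
    {Dcnst' : Type u₁} [Category.{v₁} Dcnst'] {cnst' : D₀' ⥤ Dcnst'}
    (hBinj₁ : ∀ {Y Y' : D₀ᵒᵖ} (g : Y ⟶ Y'), Injective (T.BΛ.map g).hom)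
    (hFSM₁ : ∀ {A B : D} (α : B ⟶ A), IsFSM α → IsIso α)
    (hP₁ : T.Prop34Cnst cnst)
    (hNZ₁ : ∀ A : Dᵒᵖ, ∃ u : (T.BΛ.obj (C₁.baseOp A) : Type w) × Algebra.GrothendieckGroup (C₁.Φ.carrier A),
      u ∈ C₁.cnstFn A ∧ ∃ Z : C₁.Φ.carrier A, Z ≠ 1 ∧ u.2 = Algebra.GrothendieckGroup.of Z)
    (hZQ₁ : ∀ (W : D) (𝔭 : Primes (T.Φ₀.obj (C₁.baseOp (op W)))),
      IsZMonoprime ↥𝔭.submonoid ∨ IsQMonoprime ↥𝔭.submonoid)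
    (hsat₁ : ∀ (W : D), ∀ x ∈ C₁.Φ.carrier (op W), ∃ (N : ℕ+) (d : T.Φ₀.obj (C₁.baseOp (op W))),
      x ^ (N : ℕ) = T.toR (C₁.baseOp (op W)) d)
    (hBinj₂ : ∀ {Y Y' : D₀'ᵒᵖ} (g : Y ⟶ Y'), Injective (T'.BΛ.map g).hom)
    (hFSM₂ : ∀ {A B : D'} (α : B ⟶ A), IsFSM α → IsIso α)
    (hP₂ : T'.Prop34Cnst cnst')
    (hNZ₂ : ∀ A : D'ᵒᵖ, ∃ u : (T'.BΛ.obj (C₂.baseOp A) : Type w) × Algebra.GrothendieckGroup (C₂.Φ.carrier A),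
      u ∈ C₂.cnstFn A ∧ ∃ Z : C₂.Φ.carrier A, Z ≠ 1 ∧ u.2 = Algebra.GrothendieckGroup.of Z)
    (hZQ₂ : ∀ (W : D') (𝔭 : Primes (T'.Φ₀.obj (C₂.baseOp (op W)))),
      IsZMonoprime ↥𝔭.submonoid ∨ IsQMonoprime ↥𝔭.submonoid)
    (hsat₂ : ∀ (W : D'), ∀ x ∈ C₂.Φ.carrier (op W), ∃ (N : ℕ+) (d : T'.Φ₀.obj (C₂.baseOp (op W))),
      x ^ (N : ℕ) = T'.toR (C₂.baseOp (op W)) d) :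
    Literature.AnabelianGeometry.EtaleTheta.Cor38_i
      (fun E _ => Literature.AlgebraicGeometry.Frobenioids.IsFrobeniusSlim E) h :=
  h.cor38_i_of_ratSupport (C₁.isFrobenioid_of_structural hBinj₁ hFSM₁)
    (C₂.isFrobenioid_of_structural hBinj₂ hFSM₂) hP₁.mem_FΛ_of_divΛ_eq_of hNZ₁ hZQ₁ hsat₁
    hP₂.mem_FΛ_of_divΛ_eq_of hNZ₂ hZQ₂ hsat₂

end Canonical

/-! ## §3 Both tempered Frobenioids over the CONSTRUCTED Def. 3.6 (i) data of monoid type `ℤ` / `ℚ` -/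

section Constructed

variable {D₀ : Type u₀} [Category.{v₀} D₀] {dm₁ : DivisorMonoids.{u₀, v₀, w} D₀}
  {hpf₁ : ∀ Y : D₀ᵒᵖ, IsPerfFactorial (dm₁.Φ₀.obj Y)}
  {V₁ : FrdIMonoidStub.{w}} {V₀₁ : FrdICatStub.{u₀, v₀, w} D₀}
  {D₀' : Type u₀} [Category.{v₀} D₀'] {dm₂ : DivisorMonoids.{u₀, v₀, w} D₀'}
  {hpf₂ : ∀ Y : D₀'ᵒᵖ, IsPerfFactorial (dm₂.Φ₀.obj Y)}
  {V₂ : FrdIMonoidStub.{w}} {V₀₂ : FrdICatStub.{u₀, v₀, w} D₀'}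
  {D : Type u} [Category.{v} D] {D' : Type u} [Category.{v} D']
  {VD : FrdICatStub.{u, v, w} D} {VD' : FrdICatStub.{u, v, w} D'}
  {IsRational IsStrictlyRational : (Dᵒᵖ ⥤ CommMonCat.{w}) → Prop}
  {IsRational' IsStrictlyRational' : (D'ᵒᵖ ⥤ CommMonCat.{w}) → Prop}

/-- **[EtTh] Cor. 3.8 (i) AS TYPED for two tempered Frobenioids over the constructed Def. 3.6 (i) data of monoid
type `ℤ`** (`RealifiedDivisorMonoids.ofRlfZ dm hpf`: `B₀^ℤ = B₀`, `F₀^ℤ = F₀`, `Φ₀^ℝ = Φ₀^rlf`), ANY category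
vocabularies, modulo `hF_i` ([FrdI] Thm. 5.2 (ii)) and `B₀`/`Φ₀`-LEVEL PRINT STATEMENTS ONLY: the typed Prop. 3.4
structure `dm_i.Prop34`, `hcyc_i` (Def. 3.6 (ii)(b): the divisors of constants at `Y` are integral powers of one
effective divisor — Prop. 3.4 (ii) third isomorphism `F₀(Y) ≅ L^×` with `div(ϖ_L)`), `hZQ_i` (Rmk. 3.3.1) and
`hsat_i` (rational support of `Φ_i(W)` in `Φ₀(Y_W)^rlf`) — C38-L05 by abc-iut-w5-d130's
`bsFldPreStepLimitCriterion_ofRlfZ_of_ratSupport` (`hP34Λ`, `hNZ`, `hQ` DERIVED there), C38-L01 a tree theorem,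
[FrdI] Thm. 3.4 (ii) := `FrdI.Thm34ii_holds`. [cite: MochizukiEtTh2009, Cor 3.8 p.80] -/
theorem cor38_i_ofRlfZ_of_ratSupport
    {C₁ : TemperedFrobenioid (RealifiedDivisorMonoids.ofRlfZ dm₁ hpf₁) D VD}
    {C₂ : TemperedFrobenioid (RealifiedDivisorMonoids.ofRlfZ dm₂ hpf₂) D' VD'}
    (h : Cor38Hyp C₁ C₂)
    (hF₁ : PreFrobenioid.IsFrobenioid C₁.toElem) (hF₂ : PreFrobenioid.IsFrobenioid C₂.toElem)
    (h34₁ : dm₁.Prop34 V₁ V₀₁)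
    (hcyc₁ : ∀ Y : D₀ᵒᵖ, ∃ d : dm₁.Φ₀.obj Y, ∀ b ∈ dm₁.F₀ Y, ∃ n : ℤ,
      dm₁.div₀ Y b = Algebra.GrothendieckGroup.of d ^ n)
    (hZQ₁ : ∀ (W : D) (𝔭 : Primes (dm₁.Φ₀.obj (C₁.baseOp (op W)))),
      IsZMonoprime ↥𝔭.submonoid ∨ IsQMonoprime ↥𝔭.submonoid)
    (hsat₁ : ∀ (W : D), ∀ x ∈ C₁.Φ.carrier (op W), ∃ (N : ℕ+) (d : dm₁.Φ₀.obj (C₁.baseOp (op W))),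
      x ^ (N : ℕ) = (hpf₁ (C₁.baseOp (op W))).toRealification (Perfection.of _ d))
    (h34₂ : dm₂.Prop34 V₂ V₀₂)
    (hcyc₂ : ∀ Y : D₀'ᵒᵖ, ∃ d : dm₂.Φ₀.obj Y, ∀ b ∈ dm₂.F₀ Y, ∃ n : ℤ,
      dm₂.div₀ Y b = Algebra.GrothendieckGroup.of d ^ n)
    (hZQ₂ : ∀ (W : D') (𝔭 : Primes (dm₂.Φ₀.obj (C₂.baseOp (op W)))),
      IsZMonoprime ↥𝔭.submonoid ∨ IsQMonoprime ↥𝔭.submonoid)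
    (hsat₂ : ∀ (W : D'), ∀ x ∈ C₂.Φ.carrier (op W), ∃ (N : ℕ+) (d : dm₂.Φ₀.obj (C₂.baseOp (op W))),
      x ^ (N : ℕ) = (hpf₂ (C₂.baseOp (op W))).toRealification (Perfection.of _ d)) :
    Literature.AnabelianGeometry.EtaleTheta.Cor38_i
      (fun E _ => Literature.AlgebraicGeometry.Frobenioids.IsFrobeniusSlim E) h :=
  h.cor38_i_of_criterion FrdI.Thm34ii_holds hF₁ hF₂ h.standardIsotropicNotGroupLike_treeMonoidVocab
    (C₁.bsFldPreStepLimitCriterion_ofRlfZ_of_ratSupport hF₁ h34₁ hcyc₁ hZQ₁ hsat₁)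
    (C₂.bsFldPreStepLimitCriterion_ofRlfZ_of_ratSupport hF₂ h34₂ hcyc₂ hZQ₂ hsat₂)

/-- **[EtTh] Cor. 3.8 (i) AS TYPED over the constructed `Λ = ℤ` data from NAMED `B₀`/`Φ₀`/`D`-LEVEL CLAUSES
ONLY**: as `cor38_i_ofRlfZ_of_ratSupport`, with `hF_i` consumed from abc-iut-L2-t3's `isFrobenioid_of_structural`
∘ `RealifiedDivisorMonoids.ofRlfZ_hBinj` given `hB₀inj_i` (pull-backs of `B₀` injective: "the function field of a
connected covering embeds in that of a covering above it", Def. 3.3 (iii)) and `hFSM_i` (FSM-morphisms of `D_i`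
are isomorphisms).  Inputs per side: `hB₀inj_i`, `hFSM_i`, `dm_i.Prop34`, `hcyc_i`, `hZQ_i`, `hsat_i`.
[cite: MochizukiEtTh2009, Cor 3.8 p.80] -/
theorem cor38_i_ofRlfZ_of_structural
    {C₁ : TemperedFrobenioid (RealifiedDivisorMonoids.ofRlfZ dm₁ hpf₁) D
      (treeCatVocab D IsRational IsStrictlyRational)}
    {C₂ : TemperedFrobenioid (RealifiedDivisorMonoids.ofRlfZ dm₂ hpf₂) D'
      (treeCatVocab D' IsRational' IsStrictlyRational')}
    (h : Cor38Hyp C₁ C₂)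
    (hB₀inj₁ : ∀ {Y Y' : D₀ᵒᵖ} (g : Y ⟶ Y'), Injective (dm₁.B₀.map g).hom)
    (hFSM₁ : ∀ {A B : D} (α : B ⟶ A), IsFSM α → IsIso α)
    (h34₁ : dm₁.Prop34 V₁ V₀₁)
    (hcyc₁ : ∀ Y : D₀ᵒᵖ, ∃ d : dm₁.Φ₀.obj Y, ∀ b ∈ dm₁.F₀ Y, ∃ n : ℤ,
      dm₁.div₀ Y b = Algebra.GrothendieckGroup.of d ^ n)
    (hZQ₁ : ∀ (W : D) (𝔭 : Primes (dm₁.Φ₀.obj (C₁.baseOp (op W)))),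
      IsZMonoprime ↥𝔭.submonoid ∨ IsQMonoprime ↥𝔭.submonoid)
    (hsat₁ : ∀ (W : D), ∀ x ∈ C₁.Φ.carrier (op W), ∃ (N : ℕ+) (d : dm₁.Φ₀.obj (C₁.baseOp (op W))),
      x ^ (N : ℕ) = (hpf₁ (C₁.baseOp (op W))).toRealification (Perfection.of _ d))
    (hB₀inj₂ : ∀ {Y Y' : D₀'ᵒᵖ} (g : Y ⟶ Y'), Injective (dm₂.B₀.map g).hom)
    (hFSM₂ : ∀ {A B : D'} (α : B ⟶ A), IsFSM α → IsIso α)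
    (h34₂ : dm₂.Prop34 V₂ V₀₂)
    (hcyc₂ : ∀ Y : D₀'ᵒᵖ, ∃ d : dm₂.Φ₀.obj Y, ∀ b ∈ dm₂.F₀ Y, ∃ n : ℤ,
      dm₂.div₀ Y b = Algebra.GrothendieckGroup.of d ^ n)
    (hZQ₂ : ∀ (W : D') (𝔭 : Primes (dm₂.Φ₀.obj (C₂.baseOp (op W)))),
      IsZMonoprime ↥𝔭.submonoid ∨ IsQMonoprime ↥𝔭.submonoid)
    (hsat₂ : ∀ (W : D'), ∀ x ∈ C₂.Φ.carrier (op W), ∃ (N : ℕ+) (d : dm₂.Φ₀.obj (C₂.baseOp (op W))),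
      x ^ (N : ℕ) = (hpf₂ (C₂.baseOp (op W))).toRealification (Perfection.of _ d)) :
    Literature.AnabelianGeometry.EtaleTheta.Cor38_i
      (fun E _ => Literature.AlgebraicGeometry.Frobenioids.IsFrobeniusSlim E) h :=
  h.cor38_i_ofRlfZ_of_ratSupport
    (C₁.isFrobenioid_of_structural (RealifiedDivisorMonoids.ofRlfZ_hBinj dm₁ hpf₁ hB₀inj₁) hFSM₁)
    (C₂.isFrobenioid_of_structural (RealifiedDivisorMonoids.ofRlfZ_hBinj dm₂ hpf₂ hB₀inj₂) hFSM₂)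
    h34₁ hcyc₁ hZQ₁ hsat₁ h34₂ hcyc₂ hZQ₂ hsat₂

/-- **[EtTh] Cor. 3.8 (i) AS TYPED for two tempered Frobenioids over the constructed Def. 3.6 (i) data of monoid
type `ℚ`** (`RealifiedDivisorMonoids.ofRlfQ dm hpf`: `B₀^ℚ = B₀^pf`, `F₀^ℚ = F₀^pf`, same `Φ₀^ℝ = Φ₀^rlf`), any
category vocabularies, modulo `hF_i` and the same `B₀`/`Φ₀`-level print statements `dm_i.Prop34`, `hcyc_i`,
`hZQ_i`, `hsat_i` (C38-L05 by `bsFldPreStepLimitCriterion_ofRlfQ_of_ratSupport`).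
[cite: MochizukiEtTh2009, Cor 3.8 p.80] -/
theorem cor38_i_ofRlfQ_of_ratSupport
    {C₁ : TemperedFrobenioid (RealifiedDivisorMonoids.ofRlfQ dm₁ hpf₁) D VD}
    {C₂ : TemperedFrobenioid (RealifiedDivisorMonoids.ofRlfQ dm₂ hpf₂) D' VD'}
    (h : Cor38Hyp C₁ C₂)
    (hF₁ : PreFrobenioid.IsFrobenioid C₁.toElem) (hF₂ : PreFrobenioid.IsFrobenioid C₂.toElem)
    (h34₁ : dm₁.Prop34 V₁ V₀₁)
    (hcyc₁ : ∀ Y : D₀ᵒᵖ, ∃ d : dm₁.Φ₀.obj Y, ∀ b ∈ dm₁.F₀ Y, ∃ n : ℤ,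
      dm₁.div₀ Y b = Algebra.GrothendieckGroup.of d ^ n)
    (hZQ₁ : ∀ (W : D) (𝔭 : Primes (dm₁.Φ₀.obj (C₁.baseOp (op W)))),
      IsZMonoprime ↥𝔭.submonoid ∨ IsQMonoprime ↥𝔭.submonoid)
    (hsat₁ : ∀ (W : D), ∀ x ∈ C₁.Φ.carrier (op W), ∃ (N : ℕ+) (d : dm₁.Φ₀.obj (C₁.baseOp (op W))),
      x ^ (N : ℕ) = (hpf₁ (C₁.baseOp (op W))).toRealification (Perfection.of _ d))
    (h34₂ : dm₂.Prop34 V₂ V₀₂)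
    (hcyc₂ : ∀ Y : D₀'ᵒᵖ, ∃ d : dm₂.Φ₀.obj Y, ∀ b ∈ dm₂.F₀ Y, ∃ n : ℤ,
      dm₂.div₀ Y b = Algebra.GrothendieckGroup.of d ^ n)
    (hZQ₂ : ∀ (W : D') (𝔭 : Primes (dm₂.Φ₀.obj (C₂.baseOp (op W)))),
      IsZMonoprime ↥𝔭.submonoid ∨ IsQMonoprime ↥𝔭.submonoid)
    (hsat₂ : ∀ (W : D'), ∀ x ∈ C₂.Φ.carrier (op W), ∃ (N : ℕ+) (d : dm₂.Φ₀.obj (C₂.baseOp (op W))),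
      x ^ (N : ℕ) = (hpf₂ (C₂.baseOp (op W))).toRealification (Perfection.of _ d)) :
    Literature.AnabelianGeometry.EtaleTheta.Cor38_i
      (fun E _ => Literature.AlgebraicGeometry.Frobenioids.IsFrobeniusSlim E) h :=
  h.cor38_i_of_criterion FrdI.Thm34ii_holds hF₁ hF₂ h.standardIsotropicNotGroupLike_treeMonoidVocab
    (C₁.bsFldPreStepLimitCriterion_ofRlfQ_of_ratSupport hF₁ h34₁ hcyc₁ hZQ₁ hsat₁)
    (C₂.bsFldPreStepLimitCriterion_ofRlfQ_of_ratSupport hF₂ h34₂ hcyc₂ hZQ₂ hsat₂)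

/-- **[EtTh] Cor. 3.8 (i) AS TYPED over the constructed `Λ = ℚ` data from NAMED `B₀`/`Φ₀`/`D`-LEVEL CLAUSES
ONLY**: as `cor38_i_ofRlfQ_of_ratSupport`, with `hF_i` ⟸ (`hB₀inj_i`, `hFSM_i`) through
`isFrobenioid_of_structural` ∘ `RealifiedDivisorMonoids.ofRlfQ_hBinj` (`B₀^ℚ = B₀^pf`, so `hBinj` ⟸ `hB₀inj` by
L1's `perfectionMap_injective`). [cite: MochizukiEtTh2009, Cor 3.8 p.80] -/
theorem cor38_i_ofRlfQ_of_structural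
    {C₁ : TemperedFrobenioid (RealifiedDivisorMonoids.ofRlfQ dm₁ hpf₁) D
      (treeCatVocab D IsRational IsStrictlyRational)}
    {C₂ : TemperedFrobenioid (RealifiedDivisorMonoids.ofRlfQ dm₂ hpf₂) D'
      (treeCatVocab D' IsRational' IsStrictlyRational')}
    (h : Cor38Hyp C₁ C₂)
    (hB₀inj₁ : ∀ {Y Y' : D₀ᵒᵖ} (g : Y ⟶ Y'), Injective (dm₁.B₀.map g).hom)
    (hFSM₁ : ∀ {A B : D} (α : B ⟶ A), IsFSM α → IsIso α)
    (h34₁ : dm₁.Prop34 V₁ V₀₁)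
    (hcyc₁ : ∀ Y : D₀ᵒᵖ, ∃ d : dm₁.Φ₀.obj Y, ∀ b ∈ dm₁.F₀ Y, ∃ n : ℤ,
      dm₁.div₀ Y b = Algebra.GrothendieckGroup.of d ^ n)
    (hZQ₁ : ∀ (W : D) (𝔭 : Primes (dm₁.Φ₀.obj (C₁.baseOp (op W)))),
      IsZMonoprime ↥𝔭.submonoid ∨ IsQMonoprime ↥𝔭.submonoid)
    (hsat₁ : ∀ (W : D), ∀ x ∈ C₁.Φ.carrier (op W), ∃ (N : ℕ+) (d : dm₁.Φ₀.obj (C₁.baseOp (op W))),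
      x ^ (N : ℕ) = (hpf₁ (C₁.baseOp (op W))).toRealification (Perfection.of _ d))
    (hB₀inj₂ : ∀ {Y Y' : D₀'ᵒᵖ} (g : Y ⟶ Y'), Injective (dm₂.B₀.map g).hom)
    (hFSM₂ : ∀ {A B : D'} (α : B ⟶ A), IsFSM α → IsIso α)
    (h34₂ : dm₂.Prop34 V₂ V₀₂)
    (hcyc₂ : ∀ Y : D₀'ᵒᵖ, ∃ d : dm₂.Φ₀.obj Y, ∀ b ∈ dm₂.F₀ Y, ∃ n : ℤ,
      dm₂.div₀ Y b = Algebra.GrothendieckGroup.of d ^ n)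
    (hZQ₂ : ∀ (W : D') (𝔭 : Primes (dm₂.Φ₀.obj (C₂.baseOp (op W)))),
      IsZMonoprime ↥𝔭.submonoid ∨ IsQMonoprime ↥𝔭.submonoid)
    (hsat₂ : ∀ (W : D'), ∀ x ∈ C₂.Φ.carrier (op W), ∃ (N : ℕ+) (d : dm₂.Φ₀.obj (C₂.baseOp (op W))),
      x ^ (N : ℕ) = (hpf₂ (C₂.baseOp (op W))).toRealification (Perfection.of _ d)) :
    Literature.AnabelianGeometry.EtaleTheta.Cor38_i
      (fun E _ => Literature.AlgebraicGeometry.Frobenioids.IsFrobeniusSlim E) h :=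
  h.cor38_i_ofRlfQ_of_ratSupport
    (C₁.isFrobenioid_of_structural (RealifiedDivisorMonoids.ofRlfQ_hBinj dm₁ hpf₁ hB₀inj₁) hFSM₁)
    (C₂.isFrobenioid_of_structural (RealifiedDivisorMonoids.ofRlfQ_hBinj dm₂ hpf₂ hB₀inj₂) hFSM₂)
    h34₁ hcyc₁ hZQ₁ hsat₁ h34₂ hcyc₂ hZQ₂ hsat₂

end Constructed

end Cor38Hyp

end Literature.AnabelianGeometry.EtaleTheta
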